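import Literature.AlgebraicGeometry.Resolution.BlowupsEquivariant
import Literature.AlgebraicGeometry.RelativeSpec.FiniteGroupQuotient
import HarnessLib

/-!
# Automorphisms and group actions restrict to stable reduced closed subschemes (Görtz–Wedhorn I, Props. 3.51–3.52 / (13.19))

Topic: `Literature/AlgebraicGeometry/Resolution`. Theorems only (no definition, no named fact). Companion
of the «Stable reduced centres» section of `BlowupsEquivariant.lean` (the vanishing ideal of a stable
closed subset is stable) and of `BlowupSequencesStableCentres.lean` (lifted actions preserve strict
transforms): the third piece of plumbing that equivariant birational geometry uses without comment — an
automorphism of `X` mapping a closed subset `Z` into itself RESTRICTS to the reduced induced closed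
subscheme `Z_red ↪ X` (Mathlib: `Scheme.IdealSheafData.vanishingIdeal Z` and its `subscheme`), by the
universal property of the reduced closed subscheme (GW I Props. 3.51–3.52: `f_red`, and the reduced subscheme `Z_red` as the least subscheme with underlying space `Z` ∕ Mathlib
`Scheme.IdealSheafData.subschemeMap` with `map_vanishingIdeal`: `f` restricts to `V(𝓘) → V(𝓙)` as soon as
`𝓙 ≤ f_* 𝓘`, and `f_* 𝓘_Z = 𝓘_{closure f(Z)}`).

* `vanishingIdeal_le_map_of_image_subset` — `𝓘_Z ≤ f_* 𝓘_Z` when `f(Z) ⊆ Z`;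
* `exists_restrict_vanishingIdeal_subscheme` — an endomorphism `f` of `X` with `f(Z) ⊆ Z` restricts to an
  endomorphism of `Z_red` over `f`; `restrict_unique` — uniquely (the inclusion is a monomorphism);
* `exists_aut_restrict_vanishingIdeal_subscheme` — an automorphism `e` with `e⁻¹(Z) = Z` restricts to an
  AUTOMORPHISM of `Z_red`;
* `exists_action_restrict_vanishingIdeal_subscheme`, `exists_actionOver_restrict_vanishingIdeal_subscheme`
  — a group action stabilising `Z` restricts to an action on `Z_red` (over the same base), the inclusion
  being equivariant.

Route note: brick «B2a» of the Kollár-free deck family (P-3′) for route `HodgeConjecture/Q8SymplecticPowers`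
(crux K1Q, stmt-HodgeConjecture-24190): the resolution extracted from a principalization is the REDUCED
strict transform (`exists_isResolution_of_isEmbeddedTransform`, `ProjectiveResolutionProofs.lean`), to
which the lifted action restricts by this file. General scheme plumbing; nothing here bears on HC.

## References

* [GortzWedhorn2020] U. Görtz, T. Wedhorn, Algebraic Geometry I (2nd ed.), §(3.18) Props. 3.50–3.52 (pp. 89–90:
  `X_red`, the functor `f ↦ f_red`, the reduced subscheme `Z_red` on a locally closed subset) and (13.19) (strict
  transforms, p. 414).
* [Kollar2007] J. Kollár, Lectures on Resolution of Singularities (2007), §3.4.1 (p. 121).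
-/

noncomputable section

open CategoryTheory CategoryTheory.Limits AlgebraicGeometry TopologicalSpace

namespace Literature.AlgebraicGeometry.Resolution

universe u

open Scheme.IdealSheafData

variable {X : Scheme.{u}}

/-! ## One endomorphism -/

/-- If `f(Z) ⊆ Z` for a closed subset `Z`, then `𝓘_Z ≤ f_* 𝓘_Z` (`f_* 𝓘_Z = 𝓘_{closure f(Z)}` and the
vanishing ideal is antitone). [cite: GortzWedhorn2020, Props. 3.51–3.52 (pp. 89–90)] -/
theorem vanishingIdeal_le_map_of_image_subset (f : X ⟶ X) (Z : Closeds X)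
    (hZ : f '' (Z : Set X) ⊆ Z) : vanishingIdeal Z ≤ (vanishingIdeal Z).map f := by
  rw [map_vanishingIdeal]
  apply vanishingIdeal_antimono
  rw [Closeds.closure_le]
  exact hZ

/-- **An endomorphism `f` of `X` with `f(Z) ⊆ Z` restricts to the reduced closed subscheme `Z_red`**:
there is `f̃ : Z_red ⟶ Z_red` with `f̃ ≫ ι = ι ≫ f`, `ι : Z_red ↪ X` the inclusion.
[cite: GortzWedhorn2020, Props. 3.51–3.52 (pp. 89–90)] -/
theorem exists_restrict_vanishingIdeal_subscheme (f : X ⟶ X) (Z : Closeds X)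
    (hZ : f '' (Z : Set X) ⊆ Z) :
    ∃ f' : (vanishingIdeal Z).subscheme ⟶ (vanishingIdeal Z).subscheme,
      f' ≫ (vanishingIdeal Z).subschemeι = (vanishingIdeal Z).subschemeι ≫ f :=
  ⟨subschemeMap _ _ f (vanishingIdeal_le_map_of_image_subset f Z hZ), subschemeMap_subschemeι _ _ _ _⟩

/-- Uniqueness of restrictions: two endomorphisms of `Z_red` over the same endomorphism of `X` coincide
(the inclusion is a monomorphism). [cite: GortzWedhorn2020, Props. 3.51–3.52 (pp. 89–90)] -/
theorem restrict_unique (Z : Closeds X) {f : X ⟶ X}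
    {f₁ f₂ : (vanishingIdeal Z).subscheme ⟶ (vanishingIdeal Z).subscheme}
    (h₁ : f₁ ≫ (vanishingIdeal Z).subschemeι = (vanishingIdeal Z).subschemeι ≫ f)
    (h₂ : f₂ ≫ (vanishingIdeal Z).subschemeι = (vanishingIdeal Z).subschemeι ≫ f) : f₁ = f₂ := by
  rw [← cancel_mono (vanishingIdeal Z).subschemeι, h₁, h₂]

/-- For an isomorphism `e` with `e⁻¹(Z) = Z`, also `e(Z) ⊆ Z`. [cite: GortzWedhorn2020, Props. 3.51–3.52 (pp. 89–90)] -/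
theorem image_hom_subset_of_preimage_eq (e : X ≅ X) (Z : Set X) (hZ : e.hom ⁻¹' Z = Z) :
    e.hom '' Z ⊆ Z := by
  conv_lhs => rw [← hZ]
  exact Set.image_preimage_subset _ _

/-- For an isomorphism `e` with `e⁻¹(Z) = Z`, also `e⁻¹` maps `Z` into `Z`. [cite: GortzWedhorn2020, Props. 3.51–3.52 (pp. 89–90)] -/
theorem image_inv_subset_of_preimage_eq (e : X ≅ X) (Z : Set X) (hZ : e.hom ⁻¹' Z = Z) :
    e.inv '' Z ⊆ Z := by
  rw [image_inv_eq_preimage_hom, hZ]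

/-- **An automorphism `e` of `X` with `e⁻¹(Z) = Z` restricts to an AUTOMORPHISM of `Z_red`** over `e`.
[cite: GortzWedhorn2020, Props. 3.51–3.52 (pp. 89–90)] -/
theorem exists_aut_restrict_vanishingIdeal_subscheme (e : X ≅ X) (Z : Closeds X)
    (hZ : e.hom ⁻¹' (Z : Set X) = Z) :
    ∃ e' : (vanishingIdeal Z).subscheme ≅ (vanishingIdeal Z).subscheme,
      e'.hom ≫ (vanishingIdeal Z).subschemeι = (vanishingIdeal Z).subschemeι ≫ e.hom := by
  obtain ⟨f, hf⟩ := exists_restrict_vanishingIdeal_subscheme e.hom Z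
    (image_hom_subset_of_preimage_eq e Z hZ)
  obtain ⟨g, hg⟩ := exists_restrict_vanishingIdeal_subscheme e.inv Z
    (image_inv_subset_of_preimage_eq e Z hZ)
  refine ⟨⟨f, g, ?_, ?_⟩, hf⟩
  · refine restrict_unique Z (f := 𝟙 X) ?_ (by simp)
    rw [Category.assoc, hg, reassoc_of% hf, e.hom_inv_id]
  · refine restrict_unique Z (f := 𝟙 X) ?_ (by simp)
    rw [Category.assoc, hf, reassoc_of% hg, e.inv_hom_id]

/-! ## Group actions -/

variable {G : Type*} [Group G]

/-- **A group action on `X` stabilising the closed subset `Z` restricts to an action on `Z_red`**, the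
inclusion `Z_red ↪ X` being equivariant (a homomorphism by uniqueness of restrictions; recall
`(a * b).hom = b.hom ≫ a.hom` in `Aut`). [cite: GortzWedhorn2020, Props. 3.51–3.52 (pp. 89–90)] -/
theorem exists_action_restrict_vanishingIdeal_subscheme (ρ : G →* Aut X) (Z : Closeds X)
    (hZ : ∀ g : G, (ρ g).hom ⁻¹' (Z : Set X) = Z) :
    ∃ ρ' : G →* Aut (vanishingIdeal Z).subscheme,
      ∀ g : G, (ρ' g).hom ≫ (vanishingIdeal Z).subschemeι = (vanishingIdeal Z).subschemeι ≫ (ρ g).hom := by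
  choose e he using fun g : G => exists_aut_restrict_vanishingIdeal_subscheme (ρ g) Z (hZ g)
  refine ⟨MonoidHom.mk' e fun a b => ?_, he⟩
  ext : 1
  rw [Aut.Aut_mul_def, Iso.trans_hom]
  refine restrict_unique Z (f := (ρ (a * b)).hom) (he (a * b)) ?_
  rw [map_mul, Aut.Aut_mul_def, Iso.trans_hom, Category.assoc, he a, reassoc_of% (he b)]

/-- The same in the tree's `ActionOver` currency: **an action of `G` on `X` over a base `q : X ⟶ Y`
stabilising `Z` restricts to an action on `Z_red` over `Y`** (along `Z_red ↪ X → Y`), the inclusion being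
equivariant. [cite: GortzWedhorn2020, Props. 3.51–3.52 (pp. 89–90)] -/
theorem exists_actionOver_restrict_vanishingIdeal_subscheme {Y : Scheme.{u}} {q : X ⟶ Y}
    (ρ : Literature.AlgebraicGeometry.RelativeSpec.ActionOver q G) (Z : Closeds X)
    (hZ : ∀ g : G, (ρ.aut g).hom ⁻¹' (Z : Set X) = Z) :
    ∃ ρ' : Literature.AlgebraicGeometry.RelativeSpec.ActionOver ((vanishingIdeal Z).subschemeι ≫ q) G,
      ∀ g : G, (ρ'.aut g).hom ≫ (vanishingIdeal Z).subschemeι =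
        (vanishingIdeal Z).subschemeι ≫ (ρ.aut g).hom := by
  obtain ⟨ρ', hρ'⟩ := exists_action_restrict_vanishingIdeal_subscheme ρ.aut Z hZ
  exact ⟨⟨ρ', fun g => by rw [← Category.assoc, hρ' g, Category.assoc, ρ.aut_comp]⟩, hρ'⟩

end Literature.AlgebraicGeometry.Resolution

end
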